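import Mathlib.MeasureTheory.Measure.Lebesgue.VolumeOfBalls
import Mathlib.MeasureTheory.Measure.Lebesgue.Complex
import Literature.NumberTheory.Transcendental.KZProduct
import Literature.Probability.RandomMatrix.LovasAndaiDefectFunction

/-!
# Lovas–Andai's `χ₁(1) = 2π²/3` — proof

Discharge of the named fact `LovasAndai2017_chiOne_one`
(`Literature/Probability/RandomMatrix/LovasAndaiDefectFunction.lean`): the Lebesgue measure, in
the entry coordinates `z ∈ ℝ⁴` of `X = [[z0, z1], [z2, z3]]`, of the strict operator-norm unit ball
`{X : 1 − XᵀX ≻ 0}` of `ℝ^{2×2}` is `2π²/3` [LovasAndai2017, §5, real case; their Table 2].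

## Proof (the elementary computation sketched in the fact file's module docstring)

* `posDef_fin_two_iff`: a real symmetric `2 × 2` matrix is positive definite iff its trace and
  determinant are positive.
* `posDef_one_sub_transpose_mul_self_iff`: with `u = a + d`, `v = c − b`, `w = a − d`,
  `s = b + c` one has `tr(1 − XᵀX) = 2 − (u²+v²+w²+s²)/4 · 2` and
  `16 det(1 − XᵀX) = (4 − (R₁+R₂)²)(4 − (R₁−R₂)²)`, `R₁ = √(u²+v²)`, `R₂ = √(w²+s²)`
  (`R₁ ± R₂` are twice the singular values of `X`), whence `1 − XᵀX ≻ 0 ⟺ R₁ + R₂ < 2`.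
* The linear change `z ↦ (u, v, w, s)` has determinant `−4`
  (`Measure.addHaar_preimage_linearMap`), and
  `vol{y ∈ ℝ⁴ : |(y₀,y₁)| + |(y₂,y₃)| < 2} = 8π²/3` (`volume_sumNorm_lt_two`) by Fubini over
  `ℝ² × ℝ²` (`KZ.appendMeasurableEquiv`), the area of a disc (`Complex.volume_ball` transported to
  `Fin 2 → ℝ`), and Tonelli with an auxiliary radius variable
  (`(2 − ρ)₊² = ∫₀² 𝟙[ρ < s] 2(2 − s) ds`), ending in `∫₀² 2(2−s)s² ds = 8/3`.
  Total: `(1/4) · 8π²/3 = 2π²/3`.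

## References

* [LovasAndai2017] A. Lovas, A. Andai, J. Phys. A 50 (2017) 295303, §2 Lemma 3, Def. 1, §5
  (`χ₁(1) = 2π²/3`). arXiv:1610.01410.
-/

noncomputable section

open MeasureTheory Set
open scoped ENNReal Matrix

namespace Literature.Probability.RandomMatrix

/-- A real symmetric `2 × 2` matrix is positive definite iff its trace and determinant are
positive. [folklore] -/
theorem posDef_fin_two_iff {M : Matrix (Fin 2) (Fin 2) ℝ} (hM : M.IsHermitian) :
    M.PosDef ↔ 0 < M.trace ∧ 0 < M.det := by
  have h10 : M 1 0 = M 0 1 := by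
    have h := congrFun (congrFun hM 0) 1
    simpa [Matrix.conjTranspose_apply] using h
  constructor
  · intro hp
    exact ⟨hp.trace_pos, hp.det_pos⟩
  · rintro ⟨htr, hdet⟩
    rw [Matrix.trace_fin_two] at htr
    rw [Matrix.det_fin_two, h10] at hdet
    have h00 : 0 < M 0 0 := by nlinarith [sq_nonneg (M 0 1), sq_nonneg (M 0 0)]
    refine Matrix.PosDef.of_dotProduct_mulVec_pos hM fun x hx => ?_
    have hq : star x ⬝ᵥ (M *ᵥ x) =
        M 0 0 * x 0 ^ 2 + 2 * M 0 1 * x 0 * x 1 + M 1 1 * x 1 ^ 2 := by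
      simp [Matrix.mulVec, dotProduct, Fin.sum_univ_two, h10]
      ring
    rw [hq]
    by_cases h1 : x 1 = 0
    · have h0 : x 0 ≠ 0 := by
        intro h0
        exact hx (funext fun i => by fin_cases i <;> simp [h0, h1])
      have : 0 < x 0 ^ 2 := by positivity
      rw [h1]
      nlinarith
    · have hx1 : 0 < x 1 ^ 2 := by positivity
      have key : M 0 0 * (M 0 0 * x 0 ^ 2 + 2 * M 0 1 * x 0 * x 1 + M 1 1 * x 1 ^ 2) =
          (M 0 0 * x 0 + M 0 1 * x 1) ^ 2 + (M 0 0 * M 1 1 - M 0 1 * M 0 1) * x 1 ^ 2 := by ring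
      have hpos :
          0 < (M 0 0 * x 0 + M 0 1 * x 1) ^ 2 + (M 0 0 * M 1 1 - M 0 1 * M 0 1) * x 1 ^ 2 := by
        have : 0 < (M 0 0 * M 1 1 - M 0 1 * M 0 1) * x 1 ^ 2 := mul_pos hdet hx1
        nlinarith [sq_nonneg (M 0 0 * x 0 + M 0 1 * x 1)]
      nlinarith

/-- The open disc of radius `ρ` in `ℝ²` (coordinates `Fin 2 → ℝ`) has area `π ρ²` (`0` if `ρ ≤ 0`).
[folklore] -/
theorem volume_disc_fin_two (ρ : ℝ) :
    volume {b : Fin 2 → ℝ | Real.sqrt (b 0 ^ 2 + b 1 ^ 2) < ρ} =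
      ENNReal.ofReal ρ ^ 2 * NNReal.pi := by
  have hpre : Complex.measurableEquivPi ⁻¹' {b : Fin 2 → ℝ | Real.sqrt (b 0 ^ 2 + b 1 ^ 2) < ρ} =
      Metric.ball (0 : ℂ) ρ := by
    ext a
    simp only [mem_preimage, mem_setOf_eq, Complex.measurableEquivPi_apply, Metric.mem_ball,
      dist_zero_right, Matrix.cons_val_zero, Matrix.cons_val_one]
    rw [Complex.norm_eq_sqrt_sq_add_sq]
  rw [← Complex.volume_preserving_equiv_pi.measure_preimage
    (by
      refine (measurableSet_lt ?_ measurable_const).nullMeasurableSet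
      fun_prop), hpre, Complex.volume_ball]


/-- The Euclidean norm on `ℝ²` is measurable. [folklore] -/
theorem measurable_normTwo :
    Measurable fun a : Fin 2 → ℝ => Real.sqrt (a 0 ^ 2 + a 1 ^ 2) := by
  have : Continuous fun a : Fin 2 → ℝ => Real.sqrt (a 0 ^ 2 + a 1 ^ 2) := by fun_prop
  exact this.measurable

/-- Auxiliary one-variable identity: `(2 − ρ)₊² = ∫_{0<s<2} 𝟙[ρ < s] · 2 (2 − s) ds` for `ρ ≥ 0`.
[folklore] -/
theorem ofReal_two_sub_sq_eq_lintegral {ρ : ℝ} (hρ : 0 ≤ ρ) :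
    ENNReal.ofReal (2 - ρ) ^ 2 =
      ∫⁻ s in Ioo (0 : ℝ) 2, (Ioi ρ).indicator (fun s => ENNReal.ofReal (2 * (2 - s))) s := by
  rw [lintegral_indicator measurableSet_Ioi, Measure.restrict_restrict measurableSet_Ioi]
  have hset : Ioi ρ ∩ Ioo 0 2 = Ioo ρ 2 := by
    ext s
    simp only [mem_inter_iff, mem_Ioi, mem_Ioo]
    constructor
    · rintro ⟨h1, -, h3⟩
      exact ⟨h1, h3⟩
    · rintro ⟨h1, h3⟩
      exact ⟨h1, by linarith, h3⟩
  rw [hset]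
  rcases lt_or_ge ρ 2 with hρ2 | hρ2
  · have hint : ∫ s in ρ..2, 2 * (2 - s) = (2 - ρ) ^ 2 := by
      have : (fun s : ℝ => 2 * (2 - s)) = fun s => 4 - 2 * s := by
        funext s; ring
      rw [this, intervalIntegral.integral_sub intervalIntegrable_const
        ((by fun_prop : Continuous fun s : ℝ => 2 * s).intervalIntegrable _ _),
        intervalIntegral.integral_const, intervalIntegral.integral_const_mul, integral_id]
      simp
      ring
    rw [← ENNReal.ofReal_pow (by linarith), ← hint, intervalIntegral.integral_of_le hρ2.le,
      integral_Ioc_eq_integral_Ioo]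
    rw [ofReal_integral_eq_lintegral_ofReal]
    · exact (continuous_const.mul (continuous_const.sub continuous_id)).integrableOn_Icc.mono_set
        Ioo_subset_Icc_self
    · refine (ae_restrict_iff' measurableSet_Ioo).mpr (ae_of_all _ fun s hs => ?_)
      have := hs.2
      simp only [Pi.zero_apply]
      nlinarith
  · have hempty : Ioo ρ 2 = ∅ := Ioo_eq_empty (not_lt.mpr hρ2)
    rw [hempty, Measure.restrict_empty, lintegral_zero_measure]
    have : ENNReal.ofReal (2 - ρ) = 0 := ENNReal.ofReal_eq_zero.mpr (by linarith)
    simp [this]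

/-- `∫_{ℝ²} (2 − |a|)₊² da = 8π/3`, by Tonelli with the auxiliary radius variable. [folklore] -/
theorem lintegral_ofReal_two_sub_norm_sq :
    ∫⁻ a : Fin 2 → ℝ, ENNReal.ofReal (2 - Real.sqrt (a 0 ^ 2 + a 1 ^ 2)) ^ 2 =
      ENNReal.ofReal (8 / 3) * NNReal.pi := by
  have hN := measurable_normTwo
  have step1 : ∫⁻ a : Fin 2 → ℝ, ENNReal.ofReal (2 - Real.sqrt (a 0 ^ 2 + a 1 ^ 2)) ^ 2 =
      ∫⁻ a : Fin 2 → ℝ, ∫⁻ s in Ioo (0 : ℝ) 2,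
        (Ioi (Real.sqrt (a 0 ^ 2 + a 1 ^ 2))).indicator
          (fun s => ENNReal.ofReal (2 * (2 - s))) s := by
    refine lintegral_congr fun a => ?_
    exact ofReal_two_sub_sq_eq_lintegral (Real.sqrt_nonneg _)
  rw [step1, lintegral_lintegral_swap]
  swap
  · -- measurability of the integrand in `(a, s)`
    have h1 : Measurable fun p : (Fin 2 → ℝ) × ℝ => ENNReal.ofReal (2 * (2 - p.2)) := by fun_prop
    have hset : MeasurableSet {p : (Fin 2 → ℝ) × ℝ | Real.sqrt (p.1 0 ^ 2 + p.1 1 ^ 2) < p.2} :=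
      measurableSet_lt (hN.comp measurable_fst) measurable_snd
    have : (Function.uncurry fun (a : Fin 2 → ℝ) (s : ℝ) =>
        (Ioi (Real.sqrt (a 0 ^ 2 + a 1 ^ 2))).indicator (fun s => ENNReal.ofReal (2 * (2 - s))) s) =
        {p : (Fin 2 → ℝ) × ℝ | Real.sqrt (p.1 0 ^ 2 + p.1 1 ^ 2) < p.2}.indicator fun p =>
          ENNReal.ofReal (2 * (2 - p.2)) := by
      funext p
      simp only [Function.uncurry, indicator, mem_Ioi, mem_setOf_eq]
    rw [this]
    exact (h1.indicator hset).aemeasurable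
  -- inner integral: `∫ 𝟙[|a| < s] · c da = c · vol(disc of radius s)`
  have step2 : ∀ s : ℝ, ∫⁻ a : Fin 2 → ℝ,
      (Ioi (Real.sqrt (a 0 ^ 2 + a 1 ^ 2))).indicator (fun s => ENNReal.ofReal (2 * (2 - s))) s =
        ENNReal.ofReal (2 * (2 - s)) * (ENNReal.ofReal s ^ 2 * NNReal.pi) := by
    intro s
    have : (fun a : Fin 2 → ℝ => (Ioi (Real.sqrt (a 0 ^ 2 + a 1 ^ 2))).indicator
        (fun s => ENNReal.ofReal (2 * (2 - s))) s) =
        {a : Fin 2 → ℝ | Real.sqrt (a 0 ^ 2 + a 1 ^ 2) < s}.indicator fun _ =>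
          ENNReal.ofReal (2 * (2 - s)) := by
      funext a
      simp only [indicator, mem_Ioi, mem_setOf_eq]
    rw [this, lintegral_indicator_const (measurableSet_lt hN measurable_const),
      volume_disc_fin_two]
  simp_rw [step2]
  -- evaluate the one-variable integral
  have step3 : ∫⁻ s in Ioo (0 : ℝ) 2,
      ENNReal.ofReal (2 * (2 - s)) * (ENNReal.ofReal s ^ 2 * NNReal.pi) =
        (∫⁻ s in Ioo (0 : ℝ) 2, ENNReal.ofReal (2 * (2 - s) * s ^ 2)) * NNReal.pi := by
    rw [← lintegral_mul_const _ (by fun_prop)]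
    refine setLIntegral_congr_fun measurableSet_Ioo fun s hs => ?_
    rw [← mul_assoc, ← ENNReal.ofReal_pow hs.1.le, ← ENNReal.ofReal_mul (by nlinarith [hs.2])]
  rw [step3]
  congr 1
  have hint : ∫ s in (0 : ℝ)..2, 2 * (2 - s) * s ^ 2 = 8 / 3 := by
    have : (fun s : ℝ => 2 * (2 - s) * s ^ 2) = fun s => 4 * s ^ 2 - 2 * s ^ 3 := by
      funext s; ring
    rw [this, intervalIntegral.integral_sub
      ((by fun_prop : Continuous fun s : ℝ => 4 * s ^ 2).intervalIntegrable _ _)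
      ((by fun_prop : Continuous fun s : ℝ => 2 * s ^ 3).intervalIntegrable _ _),
      intervalIntegral.integral_const_mul, intervalIntegral.integral_const_mul, integral_pow,
      integral_pow]
    norm_num
  rw [← hint, intervalIntegral.integral_of_le (by norm_num : (0 : ℝ) ≤ 2),
    integral_Ioc_eq_integral_Ioo, ofReal_integral_eq_lintegral_ofReal]
  · exact (by fun_prop : Continuous fun s : ℝ => 2 * (2 - s) * s ^ 2).integrableOn_Icc.mono_set
      Ioo_subset_Icc_self
  · refine (ae_restrict_iff' measurableSet_Ioo).mpr (ae_of_all _ fun s hs => ?_)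
    have h1 := hs.1
    have h2 := hs.2
    simp only [Pi.zero_apply]
    have : 0 ≤ s ^ 2 := sq_nonneg s
    nlinarith

open Literature.NumberTheory.Transcendental in
/-- `vol{y ∈ ℝ⁴ : |(y₀,y₁)| + |(y₂,y₃)| < 2} = 8π²/3`. [folklore] -/
theorem volume_sumNorm_lt_two :
    volume {y : Fin 4 → ℝ | Real.sqrt (y 0 ^ 2 + y 1 ^ 2) + Real.sqrt (y 2 ^ 2 + y 3 ^ 2) < 2} =
      ENNReal.ofReal (8 / 3 * Real.pi ^ 2) := by
  have hN := measurable_normTwo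
  set A := {y : Fin 4 → ℝ | Real.sqrt (y 0 ^ 2 + y 1 ^ 2) + Real.sqrt (y 2 ^ 2 + y 3 ^ 2) < 2}
    with hA
  have hpre : KZ.appendMeasurableEquiv 2 2 ⁻¹' A =
      {p : (Fin 2 → ℝ) × (Fin 2 → ℝ) |
        Real.sqrt (p.1 0 ^ 2 + p.1 1 ^ 2) + Real.sqrt (p.2 0 ^ 2 + p.2 1 ^ 2) < 2} := by
    ext p
    simp only [hA, mem_preimage, mem_setOf_eq, KZ.appendMeasurableEquiv_apply]
    have e0 : Fin.append p.1 p.2 (0 : Fin (2 + 2)) = p.1 0 := rfl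
    have e1 : Fin.append p.1 p.2 (1 : Fin (2 + 2)) = p.1 1 := rfl
    have e2 : Fin.append p.1 p.2 (2 : Fin (2 + 2)) = p.2 0 := rfl
    have e3 : Fin.append p.1 p.2 (3 : Fin (2 + 2)) = p.2 1 := rfl
    rw [e0, e1, e2, e3]
  have hmeas : MeasurableSet {p : (Fin 2 → ℝ) × (Fin 2 → ℝ) |
      Real.sqrt (p.1 0 ^ 2 + p.1 1 ^ 2) + Real.sqrt (p.2 0 ^ 2 + p.2 1 ^ 2) < 2} :=
    measurableSet_lt ((hN.comp measurable_fst).add (hN.comp measurable_snd)) measurable_const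
  rw [← (KZ.volume_preserving_appendMeasurableEquiv (n := 2) (m := 2)).map_eq,
    MeasurableEquiv.map_apply, hpre, Measure.volume_eq_prod, Measure.prod_apply hmeas]
  have hsec : ∀ a : Fin 2 → ℝ, Prod.mk a ⁻¹' {p : (Fin 2 → ℝ) × (Fin 2 → ℝ) |
      Real.sqrt (p.1 0 ^ 2 + p.1 1 ^ 2) + Real.sqrt (p.2 0 ^ 2 + p.2 1 ^ 2) < 2} =
      {b : Fin 2 → ℝ | Real.sqrt (b 0 ^ 2 + b 1 ^ 2) < 2 - Real.sqrt (a 0 ^ 2 + a 1 ^ 2)} := by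
    intro a
    ext b
    simp only [mem_preimage, mem_setOf_eq]
    constructor <;> intro h <;> linarith
  simp_rw [hsec, volume_disc_fin_two]
  have hmf : Measurable fun a : Fin 2 → ℝ =>
      ENNReal.ofReal (2 - Real.sqrt (a 0 ^ 2 + a 1 ^ 2)) ^ 2 :=
    (ENNReal.measurable_ofReal.comp (measurable_const.sub hN)).pow_const 2
  rw [lintegral_mul_const _ hmf]
  erw [lintegral_ofReal_two_sub_norm_sq]
  rw [mul_assoc, ← pow_two, ← ENNReal.coe_pow, ← NNReal.coe_real_pi]
  rw [show ENNReal.ofReal (8 / 3 * ((NNReal.pi : ℝ)) ^ 2) =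
      ENNReal.ofReal (8 / 3) * ((NNReal.pi ^ 2 : NNReal) : ℝ≥0∞) by
    rw [ENNReal.ofReal_mul (by norm_num), ← NNReal.coe_pow, ENNReal.ofReal_coe_nnreal]]

/-- Real-inequality core of the next lemma. [folklore] -/
theorem sumSqrt_lt_two_aux {R₁ R₂ : ℝ} (h1 : 0 ≤ R₁) (h2 : 0 ≤ R₂) :
    (0 < 2 - (R₁ ^ 2 + R₂ ^ 2) / 2 ∧ 0 < (4 - (R₁ + R₂) ^ 2) * (4 - (R₁ - R₂) ^ 2) / 16) ↔
      R₁ + R₂ < 2 := by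
  constructor
  · rintro ⟨htr, hdet⟩
    have hB : 0 < 4 - (R₁ - R₂) ^ 2 := by nlinarith [mul_nonneg h1 h2]
    have hA : 0 < 4 - (R₁ + R₂) ^ 2 := by
      by_contra hcon
      have hcon' : 4 - (R₁ + R₂) ^ 2 ≤ 0 := not_lt.mp hcon
      nlinarith [mul_nonneg (neg_nonneg.mpr hcon') hB.le]
    nlinarith
  · intro h
    have hA : 0 < 4 - (R₁ + R₂) ^ 2 := by
      nlinarith [mul_pos (by linarith : 0 < 2 - (R₁ + R₂)) (by linarith : 0 < 2 + (R₁ + R₂))]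
    have hB : 0 < 4 - (R₁ - R₂) ^ 2 := by
      nlinarith [mul_pos (by linarith : 0 < 2 - R₁ + R₂) (by linarith : 0 < 2 + R₁ - R₂)]
    refine ⟨?_, by positivity⟩
    nlinarith [mul_nonneg h1 h2]

/-- Lovas–Andai's Lemma 3 made explicit for `ℝ^{2×2}`: with `X = [[a, b], [c, d]]`,
`1 − XᵀX ≻ 0 ⟺ √((a+d)² + (c−b)²) + √((a−d)² + (b+c)²) < 2` (the two square roots are the sum
and the absolute difference of the two singular values of `2X`). [folklore] -/
theorem posDef_one_sub_transpose_mul_self_iff (z : Fin 4 → ℝ) :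
    (1 - (!![z 0, z 1; z 2, z 3])ᵀ * !![z 0, z 1; z 2, z 3]).PosDef ↔
      Real.sqrt ((z 0 + z 3) ^ 2 + (z 2 - z 1) ^ 2) +
        Real.sqrt ((z 0 - z 3) ^ 2 + (z 1 + z 2) ^ 2) < 2 := by
  have hH : (1 - (!![z 0, z 1; z 2, z 3])ᵀ * !![z 0, z 1; z 2, z 3]).IsHermitian := by
    refine Matrix.IsHermitian.sub Matrix.isHermitian_one ?_
    rw [Matrix.IsHermitian, Matrix.conjTranspose_eq_transpose_of_trivial, Matrix.transpose_mul,
      Matrix.transpose_transpose]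
  rw [posDef_fin_two_iff hH]
  have htr : (1 - (!![z 0, z 1; z 2, z 3])ᵀ * !![z 0, z 1; z 2, z 3]).trace =
      2 - (z 0 ^ 2 + z 1 ^ 2 + z 2 ^ 2 + z 3 ^ 2) := by
    simp [Matrix.trace_fin_two, Matrix.mul_apply, Fin.sum_univ_two]
    ring
  have hdet : (1 - (!![z 0, z 1; z 2, z 3])ᵀ * !![z 0, z 1; z 2, z 3]).det =
      1 - (z 0 ^ 2 + z 1 ^ 2 + z 2 ^ 2 + z 3 ^ 2) + (z 0 * z 3 - z 1 * z 2) ^ 2 := by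
    simp [Matrix.det_fin_two, Matrix.mul_apply, Fin.sum_univ_two]
    ring
  rw [htr, hdet]
  have h1 : Real.sqrt ((z 0 + z 3) ^ 2 + (z 2 - z 1) ^ 2) ^ 2 = (z 0 + z 3) ^ 2 + (z 2 - z 1) ^ 2 :=
    Real.sq_sqrt (by positivity)
  have h2 : Real.sqrt ((z 0 - z 3) ^ 2 + (z 1 + z 2) ^ 2) ^ 2 = (z 0 - z 3) ^ 2 + (z 1 + z 2) ^ 2 :=
    Real.sq_sqrt (by positivity)
  have hR₁0 : 0 ≤ Real.sqrt ((z 0 + z 3) ^ 2 + (z 2 - z 1) ^ 2) := Real.sqrt_nonneg _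
  have hR₂0 : 0 ≤ Real.sqrt ((z 0 - z 3) ^ 2 + (z 1 + z 2) ^ 2) := Real.sqrt_nonneg _
  generalize Real.sqrt ((z 0 + z 3) ^ 2 + (z 2 - z 1) ^ 2) = R₁ at h1 hR₁0 ⊢
  generalize Real.sqrt ((z 0 - z 3) ^ 2 + (z 1 + z 2) ^ 2) = R₂ at h2 hR₂0 ⊢
  have eF : z 0 ^ 2 + z 1 ^ 2 + z 2 ^ 2 + z 3 ^ 2 = (R₁ ^ 2 + R₂ ^ 2) / 2 := by
    linear_combination (-1 / 2 : ℝ) * h1 + (-1 / 2 : ℝ) * h2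
  have eD : z 0 * z 3 - z 1 * z 2 = (R₁ ^ 2 - R₂ ^ 2) / 4 := by
    linear_combination (-1 / 4 : ℝ) * h1 + (1 / 4 : ℝ) * h2
  have hfac : 1 - (R₁ ^ 2 + R₂ ^ 2) / 2 + ((R₁ ^ 2 - R₂ ^ 2) / 4) ^ 2 =
      (4 - (R₁ + R₂) ^ 2) * (4 - (R₁ - R₂) ^ 2) / 16 := by ring
  rw [eF, eD, hfac]
  exact sumSqrt_lt_two_aux hR₁0 hR₂0

/-- **`χ₁(1) = 2π²/3` on entries** (Lovas–Andai 2017, §5, real case): the Lebesgue measure of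
`{X ∈ ℝ^{2×2} : 1 − XᵀX ≻ 0}` in the entry coordinates is `2π²/3`. Proof: the linear change
`(a,b,c,d) ↦ (a+d, c−b, a−d, b+c)` (determinant `−4`) maps it onto `{|(y₀,y₁)| + |(y₂,y₃)| < 2}`,
of volume `8π²/3`. [cite: LovasAndai2017, §5 (χ₁(1) = 2π²/3)] -/
theorem volume_posDef_one_sub_transpose_mul_self :
    volume {z : Fin 4 → ℝ | (1 - (!![z 0, z 1; z 2, z 3])ᵀ * !![z 0, z 1; z 2, z 3]).PosDef} =
      ENNReal.ofReal (2 / 3 * Real.pi ^ 2) := by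
  set T : (Fin 4 → ℝ) →ₗ[ℝ] (Fin 4 → ℝ) :=
    Matrix.toLin' !![(1 : ℝ), 0, 0, 1; 0, -1, 1, 0; 1, 0, 0, -1; 0, 1, 1, 0] with hT
  have hdetM : (!![(1 : ℝ), 0, 0, 1; 0, -1, 1, 0; 1, 0, 0, -1; 0, 1, 1, 0]).det = -4 := by
    rw [Matrix.det_succ_row_zero]
    simp [Fin.sum_univ_succ, Matrix.det_fin_three, Matrix.submatrix_apply, Fin.succAbove]
    norm_num
  have hdetT : LinearMap.det T = -4 := by rw [hT, LinearMap.det_toLin', hdetM]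
  have hset : {z : Fin 4 → ℝ | (1 - (!![z 0, z 1; z 2, z 3])ᵀ * !![z 0, z 1; z 2, z 3]).PosDef} =
      T ⁻¹' {y : Fin 4 → ℝ |
        Real.sqrt (y 0 ^ 2 + y 1 ^ 2) + Real.sqrt (y 2 ^ 2 + y 3 ^ 2) < 2} := by
    ext z
    rw [mem_setOf_eq, posDef_one_sub_transpose_mul_self_iff, mem_preimage, mem_setOf_eq]
    have e0 : T z 0 = z 0 + z 3 := by
      simp [hT, Matrix.toLin'_apply, Matrix.mulVec, dotProduct, Fin.sum_univ_four]
    have e1 : T z 1 = z 2 - z 1 := by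
      simp [hT, Matrix.toLin'_apply, Matrix.mulVec, dotProduct, Fin.sum_univ_four]; ring
    have e2 : T z 2 = z 0 - z 3 := by
      simp [hT, Matrix.toLin'_apply, Matrix.mulVec, dotProduct, Fin.sum_univ_four]; ring
    have e3 : T z 3 = z 1 + z 2 := by
      simp [hT, Matrix.toLin'_apply, Matrix.mulVec, dotProduct, Fin.sum_univ_four]
    rw [e0, e1, e2, e3]
  rw [hset, Measure.addHaar_preimage_linearMap _ (by rw [hdetT]; norm_num), volume_sumNorm_lt_two,
    hdetT, ← ENNReal.ofReal_mul (by norm_num)]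
  congr 1
  norm_num [abs_of_pos]
  ring

/-- **Lovas–Andai 2017, §5 (real case): `χ₁(1) = 2π²/3`** — discharge of the named fact
`LovasAndai2017_chiOne_one`. [cite: LovasAndai2017, §5 (χ₁(1) = 2π²/3)] -/
theorem LovasAndai2017_chiOne_one_holds : LovasAndai2017_chiOne_one := by
  rw [LovasAndai2017_chiOne_one, lovasAndaiChiOne_one_eq]
  exact volume_posDef_one_sub_transpose_mul_self

end Literature.Probability.RandomMatrix

end
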